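import Literature.RepresentationTheory.Kovacevic2021.SU21RelativeCochainsDegreeThree
import HarnessLib

/-!
# Kovačević's `SU(2,1)`-modules: `C³(𝔤, 𝔨; V) ≅ Hom_𝔨(Λ³𝔭, V) ≅ hw(2,3) × hw(2,-3)`

Topic `RepresentationTheory/Kovacevic2021`; namespace `Literature.RepresentationTheory.Kovacevic2021`.
Definitions with bodies and theorems only; no named fact.  Completes `SU21RelativeCochainsDegreeThree` (which
proved that a relative `3`-cochain is determined by its values on `T₂ = (E₀₂,E₁₂,E₂₁)` and `T₁ = (E₀₂,E₂₀,E₂₁)`,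
highest-weight vectors of types `(2,3)`, `(2,-3)`): conversely the `3`-cochain
`threeCochain w₊ w₋ = Σ_I det_I • val_I` (sum over the four increasing triples `I` of `𝔭`-coordinates, values
`T₃ ↦ -Y_α w₊`, `T₂ ↦ w₊`, `T₁ ↦ w₋`, `T₀ ↦ Y_α w₋`) is relative (`threeCochain_mem`), so that
**`C³(𝔤, 𝔨; V) ≃ₗ hw(2,3) × hw(2,-3)`** (`relCochainThreeEquiv`) and **`dim C³ = [(2,3) ∈ S] + [(2,-3) ∈ S]`**
(`finrank_relCochain_three`): Borel–Wallach's `C³(𝔤,𝔨;V) = Hom_𝔨(Λ³𝔭, V)`, `Λ³𝔭 = F_{1,0} ⊕ F_{0,1}`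
[BorelWallach2000, I §1.2, VI 4.8 (5), Lemma 4.9], with multiplicity one [Kovacevic2021, §3 Def 1].
Consequence (sequel): `H³(J_{1,0}) = H³(J_{0,1}) = ℂ` [BorelWallach2000, VI Thm 4.11 (3)].

## References

* A. Borel, N. Wallach (2000), I §1.2 (1); VI 4.8 (5), Lemma 4.9, Thm 4.11 (11), pp. 130–133. [BorelWallach2000]
* D. Kovačević, Acta Math. Spalatensia 1 (2021) 105–125, §3 Def 1, Thm 1. [Kovacevic2021]
-/

noncomputable section

open Finsupp Module
open Literature.Algebra.Lie Literature.Algebra.Lie.ChevalleyEilenberg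

namespace Literature.RepresentationTheory.Kovacevic2021

-- Mathlib idiom (Mathlib/Algebra/Lie/OfAssociative.lean): bracket on `Matrix`/`Module.End` = commutator.
attribute [local instance 100] LieRing.ofAssociativeRing

namespace SU21Datum

variable (𝒟 : SU21Datum)

/-! ### Determinant cochains on the `𝔭`-coordinates -/

/-- the four `𝔭`-coordinates of a matrix: `(y₀₂, y₁₂, y₂₀, y₂₁)` [cite: BorelWallach2000, VI 4.7] -/
def pVec : gl3 →ₗ[ℂ] (Fin 4 → ℂ) where
  toFun y := ![y 0 2, y 1 2, y 2 0, y 2 1]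
  map_add' y z := by
    funext i
    fin_cases i <;> rfl
  map_smul' c y := by
    funext i
    fin_cases i <;> rfl

/-- The `3`-cochain `(y,z,w) ↦ det[(y,z,w) restricted to the coordinates e 0, e 1, e 2] • v`.
[cite: BorelWallach2000, I §1.2 (1)] -/
def detCochain3 (e : Fin 3 → Fin 4) (v : 𝒟.V) : Cochain ℂ gl3 𝒟.V 3 :=
  (LinearMap.smulRight (LinearMap.id : ℂ →ₗ[ℂ] ℂ) v).compAlternatingMap
    (Matrix.detRowAlternating.compLinearMap (LinearMap.funLeft ℂ ℂ e ∘ₗ pVec))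

variable {𝒟} in
/-- `detCochain3 e v (y,z,w) = det • v` with the `3 × 3` determinant written out [cite: BorelWallach2000, I §1.2 (1)] -/
theorem detCochain3_apply (e : Fin 3 → Fin 4) (v : 𝒟.V) (y z w : gl3) :
    𝒟.detCochain3 e v ![y, z, w] =
      ((pVec y) (e 0) * (pVec z) (e 1) * (pVec w) (e 2) - (pVec y) (e 0) * (pVec z) (e 2) * (pVec w) (e 1)
        - (pVec y) (e 1) * (pVec z) (e 0) * (pVec w) (e 2) + (pVec y) (e 1) * (pVec z) (e 2) * (pVec w) (e 0)
        + (pVec y) (e 2) * (pVec z) (e 0) * (pVec w) (e 1) - (pVec y) (e 2) * (pVec z) (e 1) * (pVec w) (e 0)) • v := by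
  rw [detCochain3, LinearMap.compAlternatingMap_apply, AlternatingMap.compLinearMap_apply, LinearMap.smulRight_apply,
    LinearMap.id_apply]
  congr 1
  rw [show Matrix.detRowAlternating (fun i => (LinearMap.funLeft ℂ ℂ e ∘ₗ pVec) (![y, z, w] i))
      = Matrix.det (Matrix.of fun i j => pVec (![y, z, w] i) (e j)) from rfl, Matrix.det_fin_three]
  simp only [Matrix.of_apply, Matrix.cons_val_zero, Matrix.cons_val_one, Matrix.cons_val_two, Matrix.head_cons,
    Matrix.tail_cons]

/-- the coordinate `y₀₂` [cite: BorelWallach2000, VI 4.7] -/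
@[simp] theorem pVec_apply_0 (y : gl3) : pVec y 0 = y 0 2 := rfl
/-- the coordinate `y₁₂` [cite: BorelWallach2000, VI 4.7] -/
@[simp] theorem pVec_apply_1 (y : gl3) : pVec y 1 = y 1 2 := rfl
/-- the coordinate `y₂₀` [cite: BorelWallach2000, VI 4.7] -/
@[simp] theorem pVec_apply_2 (y : gl3) : pVec y 2 = y 2 0 := rfl
/-- the coordinate `y₂₁` [cite: BorelWallach2000, VI 4.7] -/
@[simp] theorem pVec_apply_3 (y : gl3) : pVec y 3 = y 2 1 := rfl

/-! ### Slot bookkeeping (degree `3`) -/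

section Slots

variable {𝒟}

/-- updating slot `0` [folklore] -/
private theorem upd3_0' (a b c x : gl3) : Function.update ![a, b, c] 0 x = ![x, b, c] := by
  funext j
  fin_cases j <;> rfl

/-- updating slot `1` [folklore] -/
private theorem upd3_1' (a b c x : gl3) : Function.update ![a, b, c] 1 x = ![a, x, c] := by
  funext j
  fin_cases j <;> rfl

/-- updating slot `2` [folklore] -/
private theorem upd3_2' (a b c x : gl3) : Function.update ![a, b, c] 2 x = ![a, b, x] := by
  funext j
  fin_cases j <;> rfl

/-- transposing slots `0`, `1` changes the sign [folklore] -/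
private theorem swap3_01' (f : Cochain ℂ gl3 𝒟.V 3) (a b c : gl3) :
    f ![b, a, c] = -f ![a, b, c] := by
  have h := f.map_swap ![a, b, c] (i := 0) (j := 1) (by decide)
  have e : (![a, b, c] : Fin 3 → gl3) ∘ Equiv.swap 0 1 = ![b, a, c] := by
    funext k
    fin_cases k <;> rfl
  rw [e] at h
  exact h

/-- transposing slots `0`, `2` changes the sign [folklore] -/
private theorem swap3_02' (f : Cochain ℂ gl3 𝒟.V 3) (a b c : gl3) :
    f ![c, b, a] = -f ![a, b, c] := by
  have h := f.map_swap ![a, b, c] (i := 0) (j := 2) (by decide)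
  have e : (![a, b, c] : Fin 3 → gl3) ∘ Equiv.swap 0 2 = ![c, b, a] := by
    funext k
    fin_cases k <;> rfl
  rw [e] at h
  exact h

/-- transposing slots `1`, `2` changes the sign [folklore] -/
private theorem swap3_12' (f : Cochain ℂ gl3 𝒟.V 3) (a b c : gl3) :
    f ![a, c, b] = -f ![a, b, c] := by
  have h := f.map_swap ![a, b, c] (i := 1) (j := 2) (by decide)
  have e : (![a, b, c] : Fin 3 → gl3) ∘ Equiv.swap 1 2 = ![a, c, b] := by
    funext k
    fin_cases k <;> rfl
  rw [e] at h
  exact h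

/-- equal entries in slots `0`, `1` give `0` [folklore] -/
private theorem self3_01' (f : Cochain ℂ gl3 𝒟.V 3) (a c : gl3) : f ![a, a, c] = 0 :=
  f.map_eq_zero_of_eq ![a, a, c] (i := 0) (j := 1) rfl (by decide)

/-- equal entries in slots `0`, `2` give `0` [folklore] -/
private theorem self3_02' (f : Cochain ℂ gl3 𝒟.V 3) (a b : gl3) : f ![a, b, a] = 0 :=
  f.map_eq_zero_of_eq ![a, b, a] (i := 0) (j := 2) rfl (by decide)

/-- equal entries in slots `1`, `2` give `0` [folklore] -/
private theorem self3_12' (f : Cochain ℂ gl3 𝒟.V 3) (a b : gl3) : f ![a, b, b] = 0 :=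
  f.map_eq_zero_of_eq ![a, b, b] (i := 1) (j := 2) rfl (by decide)

end Slots

variable {𝒟} in
/-- **`C³(𝔤, 𝔨; V)`**: a `3`-cochain is relative iff it is `𝔨`-equivariant and horizontal.
[cite: BorelWallach2000, I §1.2 (1)] [cite: ChevalleyEilenberg1948, §28 (28.1)–(28.2)] -/
theorem mem_relCochain_three_iff (f : Cochain ℂ gl3 𝒟.V 3) :
    f ∈ 𝒟.relCochain 3 ↔
      (∀ x ∈ kSub, ∀ y z w : gl3, ⁅x, f ![y, z, w]⁆ = f ![⁅x, y⁆, z, w] + f ![y, ⁅x, z⁆, w] + f ![y, z, ⁅x, w⁆]) ∧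
        ∀ x ∈ kSub, ∀ z w : gl3, f ![x, z, w] = 0 := by
  constructor
  · intro hf
    exact ⟨fun x hx y z w => three_equivariant hf hx y z w, fun x hx z w =>
      apply_eq_zero_of_slot_mem hf ![x, z, w] 0 hx⟩
  · rintro ⟨h1, h2⟩
    rw [relCochain, Subcomplex.mem_rel_succ_iff]
    intro x hx
    refine ⟨?_, ?_⟩
    · refine AlternatingMap.ext fun v => ?_
      have hv : v = ![v 0, v 1, v 2] := by
        funext j
        fin_cases j <;> rfl
      rw [hv, lieDer_three_apply, AlternatingMap.zero_apply, h1 x hx]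
      abel
    · refine AlternatingMap.ext fun v => ?_
      have hv : v = ![v 0, v 1] := by
        funext j
        fin_cases j <;> rfl
      rw [ins_apply, AlternatingMap.zero_apply, hv]
      exact h2 x hx (v 0) (v 1)

/-! ### The relative `3`-cochain with prescribed highest-weight values -/

/-- **The relative `3`-cochain with values `w₊` on `T₂ = (E₀₂,E₁₂,E₂₁)` and `w₋` on `T₁ = (E₀₂,E₂₀,E₂₁)`**
(and the forced values `-Y_α w₊` on `T₃ = (E₀₂,E₁₂,E₂₀)`, `Y_α w₋` on `T₀ = (E₁₂,E₂₀,E₂₁)`).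
[cite: BorelWallach2000, I §1.2 (1), VI 4.8 (5)] -/
def threeCochain (wp wm : 𝒟.V) : Cochain ℂ gl3 𝒟.V 3 :=
  𝒟.detCochain3 ![0, 1, 2] (-𝒟.Ya wp) + 𝒟.detCochain3 ![0, 1, 3] wp + 𝒟.detCochain3 ![0, 2, 3] wm
    + 𝒟.detCochain3 ![1, 2, 3] (𝒟.Ya wm)

variable {𝒟} in
/-- `threeCochain` evaluated on a triple [cite: BorelWallach2000, I §1.2 (1)] -/
theorem threeCochain_apply (wp wm : 𝒟.V) (y z w : gl3) :
    𝒟.threeCochain wp wm ![y, z, w] =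
      (y 0 2 * z 1 2 * w 2 0 - y 0 2 * z 2 0 * w 1 2 - y 1 2 * z 0 2 * w 2 0 + y 1 2 * z 2 0 * w 0 2 + y 2 0 * z 0 2 * w 1 2 - y 2 0 * z 1 2 * w 0 2) • (-𝒟.Ya wp)
      + (y 0 2 * z 1 2 * w 2 1 - y 0 2 * z 2 1 * w 1 2 - y 1 2 * z 0 2 * w 2 1 + y 1 2 * z 2 1 * w 0 2 + y 2 1 * z 0 2 * w 1 2 - y 2 1 * z 1 2 * w 0 2) • wp
      + (y 0 2 * z 2 0 * w 2 1 - y 0 2 * z 2 1 * w 2 0 - y 2 0 * z 0 2 * w 2 1 + y 2 0 * z 2 1 * w 0 2 + y 2 1 * z 0 2 * w 2 0 - y 2 1 * z 2 0 * w 0 2) • wm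
      + (y 1 2 * z 2 0 * w 2 1 - y 1 2 * z 2 1 * w 2 0 - y 2 0 * z 1 2 * w 2 1 + y 2 0 * z 2 1 * w 1 2 + y 2 1 * z 1 2 * w 2 0 - y 2 1 * z 2 0 * w 1 2) • 𝒟.Ya wm := by
  simp only [threeCochain, AlternatingMap.add_apply, detCochain3_apply, pVec_apply_0, pVec_apply_1, pVec_apply_2,
    pVec_apply_3, Matrix.cons_val_zero, Matrix.cons_val_one, Matrix.cons_val_two, Matrix.head_cons,
    Matrix.tail_cons]

-- one uniform expansion of the `𝔨`-action on `u¹, u²` of `V_{2,±3}`; which simp lemmas fire varies with the term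
set_option linter.unusedSimpArgs false in
variable {𝒟} in
/-- **`threeCochain w₊ w₋` is a relative `3`-cochain** for highest-weight vectors `w₊ ∈ hw(2,3)`, `w₋ ∈ hw(2,-3)`
(`𝔨`-equivariance of `Σ_I det_I • val_I`, checked on `u¹, u² = -Y_α u¹` of `V_{2,±3}`).
[cite: BorelWallach2000, I §1.2 (1), VI Lemma 4.9] [cite: Kovacevic2021, §3 Def 1] -/
theorem threeCochain_mem {wp wm : 𝒟.V} (hp : wp ∈ 𝒟.hwSpace 2 3) (hm : wm ∈ 𝒟.hwSpace 2 (-3)) :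
    𝒟.threeCochain wp wm ∈ 𝒟.relCochain 3 := by
  rw [hwSpace_eq_span, Submodule.mem_span_singleton] at hp hm
  obtain ⟨cp, rfl⟩ := hp
  obtain ⟨cm, rfl⟩ := hm
  rw [mem_relCochain_three_iff]
  refine ⟨fun x hx y z w => ?_, fun x hx z w => ?_⟩
  · obtain ⟨h02, h12, h20, h21⟩ := (mem_kSub_iff x).1 hx
    rw [threeCochain_apply, threeCochain_apply, threeCochain_apply, threeCochain_apply, lie_def]
    simp (disch := omega) only [ρfun, h02, h12, h20, h21, zero_smul, add_zero, LinearMap.add_apply,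
      LinearMap.smul_apply, map_add, map_sub, map_smul, map_neg, map_zero, LieRing.of_associative_ring_bracket,
      Matrix.sub_apply, Matrix.mul_apply, Fin.sum_univ_three, Ha_vec, Hb_vec, Xa_vec, Ya_vec 2 3 le_rfl,
      Ya_vec 2 (-3) le_rfl, Ya_vec 2 3 (show (1 : ℤ) ≤ 1 + 1 by omega), Ya_vec 2 (-3) (show (1 : ℤ) ≤ 1 + 1 by omega),
      vec_of_not_range, smul_add, smul_sub, smul_neg, smul_smul, smul_zero, neg_zero, sub_zero, Int.cast_add,
      Int.cast_sub, Int.cast_one, Int.cast_ofNat, Int.cast_zero, Int.cast_neg, mul_zero, zero_mul, mul_one, zero_add,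
      add_zero, neg_neg, add_sub_cancel_right, sub_add_cancel, zero_sub, sub_self, neg_smul]
    match_scalars <;> ring
  · obtain ⟨h02, h12, h20, h21⟩ := (mem_kSub_iff x).1 hx
    rw [threeCochain_apply, h02, h12, h20, h21]
    simp

variable {𝒟} in
/-- **A relative `3`-cochain is the `threeCochain` of its two highest-weight values `f(T₂)`, `f(T₁)`.**
[cite: BorelWallach2000, I §1.2 (1), VI Lemma 4.9] -/
theorem eq_threeCochain {f : Cochain ℂ gl3 𝒟.V 3} (hf : f ∈ 𝒟.relCochain 3) :
    f = 𝒟.threeCochain (f ![E 0 2, E 1 2, E 2 1]) (f ![E 0 2, E 2 0, E 2 1]) := by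
  obtain ⟨d3, d0⟩ := three_descent hf
  have p1 : f ![E 0 2, E 2 0, E 1 2] = -f ![E 0 2, E 1 2, E 2 0] := by
    rw [swap3_12' f (E 0 2) (E 1 2) (E 2 0)]
  have p2 : f ![E 0 2, E 2 1, E 1 2] = -f ![E 0 2, E 1 2, E 2 1] := by
    rw [swap3_12' f (E 0 2) (E 1 2) (E 2 1)]
  have p3 : f ![E 0 2, E 2 1, E 2 0] = -f ![E 0 2, E 2 0, E 2 1] := by
    rw [swap3_12' f (E 0 2) (E 2 0) (E 2 1)]
  have p4 : f ![E 1 2, E 0 2, E 2 0] = -f ![E 0 2, E 1 2, E 2 0] := by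
    rw [swap3_01' f (E 0 2) (E 1 2) (E 2 0)]
  have p5 : f ![E 1 2, E 0 2, E 2 1] = -f ![E 0 2, E 1 2, E 2 1] := by
    rw [swap3_01' f (E 0 2) (E 1 2) (E 2 1)]
  have p6 : f ![E 1 2, E 2 0, E 0 2] = f ![E 0 2, E 1 2, E 2 0] := by
    rw [swap3_02' f (E 0 2) (E 2 0) (E 1 2), swap3_12' f (E 0 2) (E 1 2) (E 2 0), neg_neg]
  have p7 : f ![E 1 2, E 2 1, E 0 2] = f ![E 0 2, E 1 2, E 2 1] := by
    rw [swap3_02' f (E 0 2) (E 2 1) (E 1 2), swap3_12' f (E 0 2) (E 1 2) (E 2 1), neg_neg]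
  have p8 : f ![E 1 2, E 2 1, E 2 0] = -f ![E 1 2, E 2 0, E 2 1] := by
    rw [swap3_12' f (E 1 2) (E 2 0) (E 2 1)]
  have p9 : f ![E 2 0, E 0 2, E 1 2] = f ![E 0 2, E 1 2, E 2 0] := by
    rw [swap3_01' f (E 0 2) (E 2 0) (E 1 2), swap3_12' f (E 0 2) (E 1 2) (E 2 0), neg_neg]
  have p10 : f ![E 2 0, E 0 2, E 2 1] = -f ![E 0 2, E 2 0, E 2 1] := by
    rw [swap3_01' f (E 0 2) (E 2 0) (E 2 1)]
  have p11 : f ![E 2 0, E 1 2, E 0 2] = -f ![E 0 2, E 1 2, E 2 0] := by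
    rw [swap3_02' f (E 0 2) (E 1 2) (E 2 0)]
  have p12 : f ![E 2 0, E 1 2, E 2 1] = -f ![E 1 2, E 2 0, E 2 1] := by
    rw [swap3_01' f (E 1 2) (E 2 0) (E 2 1)]
  have p13 : f ![E 2 0, E 2 1, E 0 2] = f ![E 0 2, E 2 0, E 2 1] := by
    rw [swap3_02' f (E 0 2) (E 2 1) (E 2 0), swap3_12' f (E 0 2) (E 2 0) (E 2 1), neg_neg]
  have p14 : f ![E 2 0, E 2 1, E 1 2] = f ![E 1 2, E 2 0, E 2 1] := by
    rw [swap3_02' f (E 1 2) (E 2 1) (E 2 0), swap3_12' f (E 1 2) (E 2 0) (E 2 1), neg_neg]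
  have p15 : f ![E 2 1, E 0 2, E 1 2] = f ![E 0 2, E 1 2, E 2 1] := by
    rw [swap3_01' f (E 0 2) (E 2 1) (E 1 2), swap3_12' f (E 0 2) (E 1 2) (E 2 1), neg_neg]
  have p16 : f ![E 2 1, E 0 2, E 2 0] = f ![E 0 2, E 2 0, E 2 1] := by
    rw [swap3_01' f (E 0 2) (E 2 1) (E 2 0), swap3_12' f (E 0 2) (E 2 0) (E 2 1), neg_neg]
  have p17 : f ![E 2 1, E 1 2, E 0 2] = -f ![E 0 2, E 1 2, E 2 1] := by
    rw [swap3_02' f (E 0 2) (E 1 2) (E 2 1)]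
  have p18 : f ![E 2 1, E 1 2, E 2 0] = f ![E 1 2, E 2 0, E 2 1] := by
    rw [swap3_01' f (E 1 2) (E 2 1) (E 2 0), swap3_12' f (E 1 2) (E 2 0) (E 2 1), neg_neg]
  have p19 : f ![E 2 1, E 2 0, E 0 2] = -f ![E 0 2, E 2 0, E 2 1] := by
    rw [swap3_02' f (E 0 2) (E 2 0) (E 2 1)]
  have p20 : f ![E 2 1, E 2 0, E 1 2] = -f ![E 1 2, E 2 0, E 2 1] := by
    rw [swap3_02' f (E 1 2) (E 2 0) (E 2 1)]
  refine AlternatingMap.ext fun v => ?_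
  have hv : v = ![v 0, v 1, v 2] := by
    funext j
    fin_cases j <;> rfl
  rw [hv, threeCochain_apply, ← d3, ← d0]
  generalize v 0 = y
  generalize v 1 = z
  generalize v 2 = w
  rw [slot_expand3 hf ![y, z, w] 0]
  simp only [upd3_0', Matrix.cons_val_zero]
  rw [slot_expand3 hf ![E 0 2, z, w] 1, slot_expand3 hf ![E 1 2, z, w] 1, slot_expand3 hf ![E 2 0, z, w] 1, slot_expand3 hf ![E 2 1, z, w] 1]
  simp only [upd3_1', Matrix.cons_val_one, self3_01', smul_zero, add_zero, zero_add]
  rw [slot_expand3 hf ![E 0 2, E 1 2, w] 2,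
    slot_expand3 hf ![E 0 2, E 2 0, w] 2,
    slot_expand3 hf ![E 0 2, E 2 1, w] 2,
    slot_expand3 hf ![E 1 2, E 0 2, w] 2,
    slot_expand3 hf ![E 1 2, E 2 0, w] 2,
    slot_expand3 hf ![E 1 2, E 2 1, w] 2,
    slot_expand3 hf ![E 2 0, E 0 2, w] 2,
    slot_expand3 hf ![E 2 0, E 1 2, w] 2,
    slot_expand3 hf ![E 2 0, E 2 1, w] 2,
    slot_expand3 hf ![E 2 1, E 0 2, w] 2,
    slot_expand3 hf ![E 2 1, E 1 2, w] 2,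
    slot_expand3 hf ![E 2 1, E 2 0, w] 2]
  simp only [upd3_2', Matrix.cons_val_zero, Matrix.cons_val_two, Matrix.tail_cons, Matrix.head_cons,
    self3_02', self3_12', p1, p2, p3, p4, p5, p6, p7, p8, p9, p10, p11, p12, p13, p14, p15, p16, p17, p18, p19, p20, smul_zero, add_zero, smul_neg]
  module

/-- **`C³(𝔤, 𝔨; V) ≅ {hw vectors of type (2,3)} × {hw vectors of type (2,-3)}`** (`= Hom_𝔨(Λ³𝔭, V)`,
`Λ³𝔭 = F_{1,0} ⊕ F_{0,1}`), `f ↦ (f(E₀₂,E₁₂,E₂₁), f(E₀₂,E₂₀,E₂₁))`. [cite: BorelWallach2000, I §1.2 (1), VI 4.8 (5)] -/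
def relCochainThreeEquiv : 𝒟.relCochain 3 ≃ₗ[ℂ] (𝒟.hwSpace 2 3 × 𝒟.hwSpace 2 (-3)) where
  toFun f := (⟨f.1 ![E 0 2, E 1 2, E 2 1], apply_T2_mem_hwSpace f.2⟩, ⟨f.1 ![E 0 2, E 2 0, E 2 1], apply_T1_mem_hwSpace f.2⟩)
  map_add' _ _ := rfl
  map_smul' _ _ := rfl
  invFun w := ⟨𝒟.threeCochain w.1.1 w.2.1, threeCochain_mem w.1.2 w.2.2⟩
  left_inv f := Subtype.ext (eq_threeCochain f.2).symm
  right_inv w := by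
    refine Prod.ext ?_ ?_ <;> apply Subtype.ext <;> simp [threeCochain_apply]

open Classical in
/-- **`dim C³(𝔤, 𝔨; V) = [(2,3) ∈ S] + [(2,-3) ∈ S]`**. [cite: BorelWallach2000, VI 4.8 (5), Thm 4.11 (11)] -/
theorem finrank_relCochain_three :
    finrank ℂ (𝒟.relCochain 3) =
      (if ((2 : ℤ), (3 : ℤ)) ∈ 𝒟.S then 1 else 0) + (if ((2 : ℤ), (-3 : ℤ)) ∈ 𝒟.S then 1 else 0) := by
  rw [LinearEquiv.finrank_eq 𝒟.relCochainThreeEquiv, Module.finrank_prod, finrank_hwSpace, finrank_hwSpace]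

end SU21Datum

end Literature.RepresentationTheory.Kovacevic2021
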